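import Literature.Probability.RandomPlanarGeometry.SAWPulledBridgeZdOrnsteinZernikeAmplitude
import HarnessLib

/-!
# Finite-size control of pulled bridges on `ℤ^{d+1}`, explicit and uniform in the dimension:
# `(1 − 23(2d+1)/y)·e^{nλ_B(y)} ≤ Z^B_n(y) ≤ e^{nλ_B(y)}` and `0 ≤ λ_B(y) − n⁻¹ log Z^B_n(y) ≤ 28(2d+1)/(n·y)` for EVERY `n ≥ 1`,
# every `y ≥ 144(2d+1)`, every `d`

Topic `Literature/Probability/RandomPlanarGeometry` (a corollary leaf over `SAWPulledBridgeZdOrnsteinZernikeAmplitude.lean` — the amplitude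
window `m(y) ≤ 1 + 23(2d+1)/y` — and the tree's all-`n` renewal sandwich `2 − m(y) ≤ a_n(y) ≤ 1`
(`SAWPulledLargeForceExpansionZdLinearRadius.pulledGap_linear`, third component; Madras–Slade (B.5)) and Fekete bound
`SAWPulledBridgeFreeEnergy.log_div_le_pulledBridgeFreeEnergy`).

Fekete's lemma gives `n⁻¹ log Z^B_n(y) ↑ λ_B(y)` with no rate.  In the large-force regime the renewal structure supplies one, uniformly in
the dimension and in the length:

* `one_sub_le_pulledAmp_linear` — `1 − 23(2d+1)/y ≤ Z^B_n(y)e^{−nλ_B(y)} ≤ 1` for EVERY `n` (not only asymptotically);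
* ★ `sub_mul_exp_le_pulledBridgeZ_linear` — `(1 − 23(2d+1)/y)·e^{nλ_B(y)} ≤ Z^B_n(y) ≤ e^{nλ_B(y)}`;
* ★★ **`pulledBridgeFreeEnergy_sub_log_div_mem_Icc_linear (hn : 1 ≤ n) :
  λ_B(y) − n⁻¹·log Z^B_n(y) ∈ [0, 28(2d+1)/(n·y)]`** — an explicit `O(1/n)` finite-size rate for the bridge free energy, every `d`;
* `planar_pulledBridgeFreeEnergy_sub_log_div_le` — on `ℤ²`, `y ≥ 432`: `0 ≤ λ_B(y) − n⁻¹ log Z^B_n(y) ≤ 84/(n·y)`.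

Printed status: the sandwich `(2 − m)e^{nλ} ≤ Z^B_n ≤ e^{nλ}` is Madras–Slade (B.5) / Ioffe–Velenik (3.31)–(3.33) with an inexplicit `m`;
the explicit constants are, to our knowledge, not in print.  Provenance: lane «pcv-sawmu», a-p3 g26 (2026-08-28).  PURE STD, no data.
-/

noncomputable section

open Finset Filter Topology
open scoped BigOperators
open Literature.Probability.LatticeModels
open Literature.Probability.RandomPlanarGeometry.SAW

namespace Literature.Probability.RandomPlanarGeometry.SAW.Zd

/-- **All-`n` amplitude sandwich, explicit**: for every `d`, `y ≥ 144(2d+1)` and every `n`,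
`1 − 23(2d+1)/y ≤ a_n(y) = Z^B_n(y)e^{−nλ_B(y)} ≤ 1` (`2 − m ≤ a_n ≤ 1` with `m ≤ 1 + 23(2d+1)/y`).
[cite: MadrasSlade1993, Appendix B, (B.5)] [cite: IoffeVelenik2008, (3.31)–(3.33)] -/
theorem one_sub_le_pulledAmp_linear (d : ℕ) {y : ℝ} (hy : 144 * (2 * d + 1 : ℝ) ≤ y) (n : ℕ) :
    1 - 23 * ((2 * d + 1) / y) ≤ pulledAmp (d + 1) y n ∧ pulledAmp (d + 1) y n ≤ 1 := by
  have hD : (0 : ℝ) < 2 * d + 1 := by positivity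
  have hy4 : 4 * (2 * d + 1 : ℝ) < y := by linarith
  obtain ⟨-, -, hsand, -⟩ := pulledGap_linear d hy4
  obtain ⟨h1, h2⟩ := hsand n
  have hm := (pulledMeanBlock_mem_Icc_linear d hy).2
  exact ⟨by linarith, h2⟩

/-- ★ **All-`n` partition-function sandwich, explicit and uniform in the dimension**: for every `d`, `y ≥ 144(2d+1)` and every `n`,
`(1 − 23(2d+1)/y)·e^{nλ_B(y)} ≤ Z^B_n(y) ≤ e^{nλ_B(y)}`. [cite: MadrasSlade1993, Appendix B, (B.5)] [cite: Beaton2015, §3] -/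
theorem sub_mul_exp_le_pulledBridgeZ_linear (d : ℕ) {y : ℝ} (hy : 144 * (2 * d + 1 : ℝ) ≤ y) (n : ℕ) :
    (1 - 23 * ((2 * d + 1) / y)) * Real.exp (n * pulledBridgeFreeEnergy (d + 1) y) ≤ pulledBridgeZ (d + 1) n y ∧
      pulledBridgeZ (d + 1) n y ≤ Real.exp (n * pulledBridgeFreeEnergy (d + 1) y) := by
  obtain ⟨h1, h2⟩ := one_sub_le_pulledAmp_linear d hy n
  have hE : 0 < Real.exp (n * pulledBridgeFreeEnergy (d + 1) y) := Real.exp_pos _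
  have hA : pulledAmp (d + 1) y n * Real.exp (n * pulledBridgeFreeEnergy (d + 1) y) = pulledBridgeZ (d + 1) n y := by
    rw [pulledAmp, mul_assoc, ← Real.exp_add,
      show -(n : ℝ) * pulledBridgeFreeEnergy (d + 1) y + n * pulledBridgeFreeEnergy (d + 1) y = 0 by ring,
      Real.exp_zero, mul_one]
  rw [← hA]
  exact ⟨mul_le_mul_of_nonneg_right h1 hE.le, by nlinarith⟩

/-- ★★ **EXPLICIT FINITE-SIZE RATE FOR THE BRIDGE FREE ENERGY, EVERY DIMENSION**: for every `d`, every `y ≥ 144(2d+1)` and every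
`n ≥ 1`, `0 ≤ λ_B(y) − n⁻¹·log Z^B_n(y) ≤ 28(2d+1)/(n·y)` (Fekete's monotone limit with an explicit `O(1/n)` rate:
`−log(1 − 23q) ≤ 23q/(1 − 23q) ≤ 28q` for `q = (2d+1)/y ≤ 1/144`). [cite: MadrasSlade1993, Lemma 1.2.2 and Appendix B, (B.5)] -/
theorem pulledBridgeFreeEnergy_sub_log_div_mem_Icc_linear (d : ℕ) {y : ℝ} (hy : 144 * (2 * d + 1 : ℝ) ≤ y) {n : ℕ} (hn : 1 ≤ n) :
    pulledBridgeFreeEnergy (d + 1) y - Real.log (pulledBridgeZ (d + 1) n y) / n ∈ Set.Icc 0 (28 * (2 * d + 1) / (n * y)) := by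
  have hD : (0 : ℝ) < 2 * d + 1 := by positivity
  have hy0 : 0 < y := by linarith
  have hn0 : (0 : ℝ) < n := by exact_mod_cast hn
  refine ⟨by linarith [log_div_le_pulledBridgeFreeEnergy d hy0 hn], ?_⟩
  -- `q ≤ 1/144`, `x := 1 − 23q ≥ 121/144 > 0`
  set q : ℝ := (2 * d + 1) / y with hq
  have hq0 : 0 ≤ q := by positivity
  have hq1 : q ≤ 1 / 144 := by rw [hq, div_le_iff₀ hy0]; linarith
  have hx0 : 0 < 1 - 23 * q := by linarith
  obtain ⟨hlow, -⟩ := sub_mul_exp_le_pulledBridgeZ_linear d hy n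
  have hZ : 0 < pulledBridgeZ (d + 1) n y := pulledBridgeZ_pos d n hy0
  -- `log Z ≥ log(1 − 23q) + nλ`
  have hlog : Real.log (1 - 23 * q) + n * pulledBridgeFreeEnergy (d + 1) y ≤ Real.log (pulledBridgeZ (d + 1) n y) := by
    rw [← Real.log_exp (n * pulledBridgeFreeEnergy (d + 1) y), ← Real.log_mul hx0.ne' (Real.exp_pos _).ne']
    exact Real.log_le_log (mul_pos hx0 (Real.exp_pos _)) hlow
  -- `−log(1 − 23q) ≤ 23q/(1 − 23q) ≤ 28q`
  have hlog2 : -(28 * q) ≤ Real.log (1 - 23 * q) := by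
    have h := Real.one_sub_inv_le_log_of_pos hx0
    have hinv : (1 - 23 * q)⁻¹ ≤ 1 + 28 * q := by
      rw [inv_le_iff_one_le_mul₀ hx0]; nlinarith
    linarith
  have hmain : pulledBridgeFreeEnergy (d + 1) y - Real.log (pulledBridgeZ (d + 1) n y) / n ≤ 28 * q / n := by
    rw [sub_le_iff_le_add, ← add_div, le_div_iff₀ hn0]
    linarith
  calc pulledBridgeFreeEnergy (d + 1) y - Real.log (pulledBridgeZ (d + 1) n y) / n ≤ 28 * q / n := hmain
    _ = 28 * (2 * d + 1) / (n * y) := by rw [hq]; field_simp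

/-- The same as an absolute value: `|n⁻¹ log Z^B_n(y) − λ_B(y)| ≤ 28(2d+1)/(n·y)` (`n ≥ 1`, `y ≥ 144(2d+1)`, every `d`).
[cite: MadrasSlade1993, Lemma 1.2.2 and Appendix B, (B.5)] -/
theorem abs_log_pulledBridgeZ_div_sub_le_linear (d : ℕ) {y : ℝ} (hy : 144 * (2 * d + 1 : ℝ) ≤ y) {n : ℕ} (hn : 1 ≤ n) :
    |Real.log (pulledBridgeZ (d + 1) n y) / n - pulledBridgeFreeEnergy (d + 1) y| ≤ 28 * (2 * d + 1) / (n * y) := by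
  obtain ⟨h0, h1⟩ := pulledBridgeFreeEnergy_sub_log_div_mem_Icc_linear d hy hn
  rw [abs_sub_comm, abs_of_nonneg h0]
  exact h1

/-- **Planar instance** (`d = 1`, `ℤ²`): for every `y ≥ 432` and every `n ≥ 1`, `0 ≤ λ_B(y) − n⁻¹ log Z^B_n(y) ≤ 84/(n·y)` and
`(1 − 69/y)·e^{nλ_B(y)} ≤ Z^B_n(y) ≤ e^{nλ_B(y)}`. [cite: MadrasSlade1993, Lemma 1.2.2 and Appendix B, (B.5)] [cite: Beaton2015, §3] -/
theorem planar_pulledBridgeFreeEnergy_sub_log_div_le {y : ℝ} (hy : 432 ≤ y) {n : ℕ} (hn : 1 ≤ n) :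
    pulledBridgeFreeEnergy 2 y - Real.log (pulledBridgeZ 2 n y) / n ∈ Set.Icc 0 (84 / (n * y)) ∧
      (1 - 69 / y) * Real.exp (n * pulledBridgeFreeEnergy 2 y) ≤ pulledBridgeZ 2 n y := by
  have hy' : 144 * (2 * (1 : ℕ) + 1 : ℝ) ≤ y := by push_cast; linarith
  have h1 := pulledBridgeFreeEnergy_sub_log_div_mem_Icc_linear 1 hy' hn
  have h2 := (sub_mul_exp_le_pulledBridgeZ_linear 1 hy' n).1
  have e1 : (28 : ℝ) * (2 * (1 : ℕ) + 1) / (n * y) = 84 / (n * y) := by push_cast; ring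
  have e2 : (1 : ℝ) - 23 * ((2 * (1 : ℕ) + 1) / y) = 1 - 69 / y := by push_cast; ring
  rw [e1] at h1
  rw [e2] at h2
  exact ⟨h1, h2⟩

end Literature.Probability.RandomPlanarGeometry.SAW.Zd
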